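import Mathlib
import HarnessLib
import Summits.ABC.ABC.Theorems.ParitySliceConcordantNormsBreedingArith

/-!
# `ParitySliceConcordantNorms` Assembly, part 2/3 — the three breeding maps `𝔅`, `𝔊`, `ℌ`

For an abc-triple `(a, b, c)` with square top `c` that violates one of the side conditions of the residual set of
`SquareTopResidualFinite`, an explicit polynomial identity breeds a NON-square-top abc-triple `(A/g, B/g, C'/g)`:
* `𝔅` (`b ∉ □`, `a < 3b`; degree 3): `c·(2b−a)² + a²(3b−a) = 4b³`, `gcd ∣ 4`, `c³ ≤ 81·C'/g`, `rad ≤ 24c²·rad(abc)`;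
* `𝔊` (`a > 2b`, `a − b ∉ □`; degree 4): `a³(a−2b) + b³(2a−b) = c(a−b)³`, `gcd ∣ 3`, `c⁴ ≤ 81·C'/g`, `rad ≤ 24c³·rad(abc)`;
* `ℌ` (`a + 3b ∉ □ ∪ 3□`; degree 4): `a(a+2b)³ + b³(2a+3b) = c³(a+3b)`, `gcd ∣ 3`, same bounds.
Non-squareness of the new top comes from a prime of odd exponent in `b`, `a − b`, resp. a prime `≠ 3` of odd
exponent in `a + 3b` (this is where `c ∈ □` is used).  Main file: `Theorems/ParitySliceConcordantNormsAssembly.lean`.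
Unconditional; standard axioms; no named facts; no `def`s.  (Crux strategist `planner-cstrat-stmt-ABC-4010-r1-0`.)
-/

-- `Summit.<Summit>.<Problem>`: for the single-conjunct summit `ABC` the duplicate `ABC.ABC` is mandated.
set_option linter.dupNamespace false

namespace Summit.ABC.ABC.Theorems.ParitySliceAssembly

open Literature.NumberTheory.DiophantineGeometry
open Summit.ABC.ABC.Theses.ParitySliceConcordantNorms
open UniqueFactorizationMonoid

/-! ## §4 The three breeding maps (degree 3 `𝔅`, degree 4 `𝔊` and `ℌ`) -/

/-- `ℌ`: when `a + 3b ∉ {□, 3□}` breed `a(a+2b)³ + b³(2a+3b) = c³(a+3b)`. -/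
theorem breed_H {a b c : ℕ} (ht : IsABCTriple a b c) (hc : IsSquare c)
    (h1 : ¬ IsSquare (a + 3 * b)) (h3 : ¬ IsSquare (3 * (a + 3 * b))) :
    ∃ A' B' C' : ℕ, IsABCTriple A' B' C' ∧ ¬ IsSquare C' ∧ c ^ 4 ≤ 81 * C' ∧
      rad A' B' C' ≤ 24 * c ^ (4 - 1) * rad a b c := by
  obtain ⟨ha, hb, rfl, hcop⟩ := ht
  obtain ⟨p, hp, hp3, hodd⟩ :=
    exists_odd_factorization_ne_three (by positivity : a + 3 * b ≠ 0) h1 h3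
  have hpab : p ∣ a + 3 * b := dvd_of_odd_factorization hodd
  -- a prime dividing `a + 3b` and one of `a`, `a + 2b` divides both legs
  have key : ∀ q : ℕ, q.Prime → q ≠ 3 → q ∣ a + 3 * b → (q ∣ a ∨ q ∣ a + 2 * b) → False := by
    intro q hq hq3 hqab hor
    have hqb_of_a : q ∣ a → q ∣ b := fun hqa => by
      have h3b : q ∣ 3 * b := (Nat.dvd_add_right hqa).mp hqab
      rcases (Nat.Prime.dvd_mul hq).mp h3b with h | h
      · exact absurd ((Nat.prime_dvd_prime_iff_eq hq Nat.prime_three).mp h) hq3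
      · exact h
    rcases hor with hqa | hq2
    · exact SparseGoodScales.Negative.not_dvd_of_coprime hq hcop hqa (hqb_of_a hqa)
    · have hqb : q ∣ b := by
        have e : a + 3 * b = (a + 2 * b) + b := by ring
        rw [e] at hqab
        exact (Nat.dvd_add_right hq2).mp hqab
      exact SparseGoodScales.Negative.not_dvd_of_coprime hq hcop ((Nat.dvd_add_left (dvd_mul_of_dvd_right hqb 2)).mp hq2) hqb
  have hpA : ¬ p ∣ a * (a + 2 * b) ^ 3 := by
    intro h
    rcases (Nat.Prime.dvd_mul hp).mp h with h' | h'
    · exact key p hp hp3 hpab (Or.inl h')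
    · exact key p hp hp3 hpab (Or.inr (hp.dvd_of_dvd_pow h'))
  refine breed_generic (A := a * (a + 2 * b) ^ 3) (B := b ^ 3 * (2 * a + 3 * b))
    (C := (a + b) ^ 3 * (a + 3 * b)) (κ := 3) (p := p) (by positivity) (by positivity) (by ring)
    hpA ?_ ?_ (by norm_num) ?_ ?_
  · -- parity of v_p(C)
    rw [Nat.factorization_mul (by positivity) (by positivity), Nat.factorization_pow,
      Finsupp.add_apply, Finsupp.smul_apply, smul_eq_mul]
    exact Even.add_odd ((even_factorization_of_isSquare (by positivity) hc p).mul_left 3) hodd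
  · -- gcd ∣ 3
    have hgA := Nat.gcd_dvd_left (a * (a + 2 * b) ^ 3) (b ^ 3 * (2 * a + 3 * b))
    have hgB := Nat.gcd_dvd_right (a * (a + 2 * b) ^ 3) (b ^ 3 * (2 * a + 3 * b))
    generalize Nat.gcd (a * (a + 2 * b) ^ 3) (b ^ 3 * (2 * a + 3 * b)) = g at hgA hgB ⊢
    have hcb : Nat.Coprime g b := Nat.coprime_of_dvd fun q hq hqg hqb => by
      rcases (Nat.Prime.dvd_mul hq).mp (hqg.trans hgA) with h | h
      · exact SparseGoodScales.Negative.not_dvd_of_coprime hq hcop h hqb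
      · exact SparseGoodScales.Negative.not_dvd_of_coprime hq hcop
          ((Nat.dvd_add_left (dvd_mul_of_dvd_right hqb 2)).mp (hq.dvd_of_dvd_pow h)) hqb
    have hca2 : Nat.Coprime g (a + 2 * b) := Nat.coprime_of_dvd fun q hq hqg hq2 => by
      have hqb : q ∣ b := by
        rcases (Nat.Prime.dvd_mul hq).mp (hqg.trans hgB) with h | h
        · exact hq.dvd_of_dvd_pow h
        · have h2 : q ∣ 2 * (a + 2 * b) := dvd_mul_of_dvd_right hq2 2
          have e : 2 * (a + 2 * b) = (2 * a + 3 * b) + b := by ring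
          rw [e] at h2
          exact (Nat.dvd_add_right h).mp h2
      exact SparseGoodScales.Negative.not_dvd_of_coprime hq hcop ((Nat.dvd_add_left (dvd_mul_of_dvd_right hqb 2)).mp hq2) hqb
    have h1 : g ∣ 2 * a + 3 * b := (Nat.Coprime.pow_right 3 hcb).dvd_of_dvd_mul_left hgB
    have h2 : g ∣ a := (Nat.Coprime.pow_right 3 hca2).dvd_of_dvd_mul_right hgA
    have h3 : g ∣ 3 * b := (Nat.dvd_add_right (dvd_mul_of_dvd_right h2 2)).mp h1
    exact hcb.dvd_of_dvd_mul_right h3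
  · -- size: 3 c^4 ≤ 81 c^3 (a + 3b)
    calc 3 * (a + b) ^ 4 = (a + b) ^ 3 * (3 * (a + b)) := by ring
      _ ≤ (a + b) ^ 3 * (81 * (a + 3 * b)) := Nat.mul_le_mul_left _ (by omega)
      _ = 81 * ((a + b) ^ 3 * (a + 3 * b)) := by ring
  · -- radical
    have e : a * (a + 2 * b) ^ 3 * (b ^ 3 * (2 * a + 3 * b)) * ((a + b) ^ 3 * (a + 3 * b)) =
        (a ^ 1 * b ^ 3 * (a + b) ^ 3) * ((a + 2 * b) ^ 3 * ((2 * a + 3 * b) * (a + 3 * b))) := by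
      ring
    rw [e]
    calc radical ((a ^ 1 * b ^ 3 * (a + b) ^ 3) * ((a + 2 * b) ^ 3 * ((2 * a + 3 * b) * (a + 3 * b))))
          ≤ rad a b (a + b) * ((a + 2 * b) * ((2 * a + 3 * b) * (a + 3 * b))) :=
          radical_bred_le ha hb (by positivity) (by norm_num) le_rfl le_rfl (by positivity)
            (by positivity)
      _ ≤ rad a b (a + b) * ((2 * (a + b)) * ((3 * (a + b)) * (3 * (a + b)))) := by
          gcongr <;> omega
      _ = 18 * (a + b) ^ (4 - 1) * rad a b (a + b) := by ring
      _ ≤ 24 * (a + b) ^ (4 - 1) * rad a b (a + b) := by gcongr; norm_num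

/-- `𝔊`: when `a > 2b` and `a - b ∉ □` breed `a³(a-2b) + b³(2a-b) = c(a-b)³`. -/
theorem breed_G {a b c : ℕ} (ht : IsABCTriple a b c) (hc : IsSquare c)
    (h2 : 2 * b < a) (hab : ¬ IsSquare (a - b)) :
    ∃ A' B' C' : ℕ, IsABCTriple A' B' C' ∧ ¬ IsSquare C' ∧ c ^ 4 ≤ 81 * C' ∧
      rad A' B' C' ≤ 24 * c ^ (4 - 1) * rad a b c := by
  obtain ⟨ha, hb, rfl, hcop⟩ := ht
  have hba : b ≤ a := by omega
  have h2b : 2 * b ≤ a := by omega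
  have hb2a : b ≤ 2 * a := by omega
  have hab0 : a - b ≠ 0 := by omega
  obtain ⟨p, hp, hodd⟩ := exists_odd_factorization_of_not_isSquare hab0 hab
  have hpab : p ∣ a - b := dvd_of_odd_factorization hodd
  have hpA : ¬ p ∣ a ^ 3 * (a - 2 * b) := by
    intro h
    rcases (Nat.Prime.dvd_mul hp).mp h with h' | h'
    · have hpa : p ∣ a := hp.dvd_of_dvd_pow h'
      have hpb : p ∣ b := by
        have := Nat.dvd_sub hpa hpab
        rwa [Nat.sub_sub_self hba] at this
      exact SparseGoodScales.Negative.not_dvd_of_coprime hp hcop hpa hpb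
    · have hpb : p ∣ b := by
        have := Nat.dvd_sub hpab h'
        have e : a - b - (a - 2 * b) = b := by omega
        rwa [e] at this
      have hpa : p ∣ a := by
        have := dvd_add hpab hpb
        rwa [Nat.sub_add_cancel hba] at this
      exact SparseGoodScales.Negative.not_dvd_of_coprime hp hcop hpa hpb
  have hid : a ^ 3 * (a - 2 * b) + b ^ 3 * (2 * a - b) = (a + b) * (a - b) ^ 3 := by
    zify [hba, h2b, hb2a]
    ring
  refine breed_generic (A := a ^ 3 * (a - 2 * b)) (B := b ^ 3 * (2 * a - b))
    (C := (a + b) * (a - b) ^ 3) (κ := 3) (p := p)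
    (Nat.mul_pos (by positivity) (by omega)) (Nat.mul_pos (by positivity) (by omega)) hid
    hpA ?_ ?_ (by norm_num) ?_ ?_
  · rw [Nat.factorization_mul (by positivity) (pow_ne_zero 3 hab0), Nat.factorization_pow,
      Finsupp.add_apply, Finsupp.smul_apply, smul_eq_mul]
    exact Even.add_odd (even_factorization_of_isSquare (by positivity) hc p)
      (Odd.mul (by decide) hodd)
  · have hgA := Nat.gcd_dvd_left (a ^ 3 * (a - 2 * b)) (b ^ 3 * (2 * a - b))
    have hgB := Nat.gcd_dvd_right (a ^ 3 * (a - 2 * b)) (b ^ 3 * (2 * a - b))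
    generalize Nat.gcd (a ^ 3 * (a - 2 * b)) (b ^ 3 * (2 * a - b)) = g at hgA hgB ⊢
    have hcb : Nat.Coprime g b := Nat.coprime_of_dvd fun q hq hqg hqb => by
      rcases (Nat.Prime.dvd_mul hq).mp (hqg.trans hgA) with h | h
      · exact SparseGoodScales.Negative.not_dvd_of_coprime hq hcop (hq.dvd_of_dvd_pow h) hqb
      · have hqa : q ∣ a := by
          have := dvd_add h (dvd_mul_of_dvd_right hqb 2)
          rwa [Nat.sub_add_cancel h2b] at this
        exact SparseGoodScales.Negative.not_dvd_of_coprime hq hcop hqa hqb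
    have hca : Nat.Coprime g a := Nat.coprime_of_dvd fun q hq hqg hqa => by
      rcases (Nat.Prime.dvd_mul hq).mp (hqg.trans hgB) with h | h
      · exact SparseGoodScales.Negative.not_dvd_of_coprime hq hcop hqa (hq.dvd_of_dvd_pow h)
      · have hqb : q ∣ b := by
          have := Nat.dvd_sub (dvd_mul_of_dvd_right hqa 2) h
          rwa [Nat.sub_sub_self hb2a] at this
        exact SparseGoodScales.Negative.not_dvd_of_coprime hq hcop hqa hqb
    have h1 : g ∣ 2 * a - b := (Nat.Coprime.pow_right 3 hcb).dvd_of_dvd_mul_left hgB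
    have h1' : g ∣ a - 2 * b := (Nat.Coprime.pow_right 3 hca).dvd_of_dvd_mul_left hgA
    have h3 : g ∣ 3 * b := by
      have := Nat.dvd_sub h1 (dvd_mul_of_dvd_right h1' 2)
      have e : 2 * a - b - 2 * (a - 2 * b) = 3 * b := by omega
      rwa [e] at this
    exact hcb.dvd_of_dvd_mul_right h3
  · -- size: 3 c^4 ≤ 81 c (a - b)^3, from c ≤ 3 (a - b)
    have hle : a + b ≤ 3 * (a - b) := by omega
    calc 3 * (a + b) ^ 4 = 3 * (a + b) * (a + b) ^ 3 := by ring
      _ ≤ 3 * (a + b) * (3 * (a - b)) ^ 3 := Nat.mul_le_mul_left _ (Nat.pow_le_pow_left hle 3)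
      _ = 81 * ((a + b) * (a - b) ^ 3) := by ring
  · have e : a ^ 3 * (a - 2 * b) * (b ^ 3 * (2 * a - b)) * ((a + b) * (a - b) ^ 3) =
        (a ^ 3 * b ^ 3 * (a + b) ^ 1) * ((a - b) ^ 3 * ((a - 2 * b) * (2 * a - b))) := by ring
    rw [e]
    calc radical ((a ^ 3 * b ^ 3 * (a + b) ^ 1) * ((a - b) ^ 3 * ((a - 2 * b) * (2 * a - b))))
          ≤ rad a b (a + b) * ((a - b) * ((a - 2 * b) * (2 * a - b))) :=
          radical_bred_le ha hb (by positivity) le_rfl le_rfl (by norm_num) hab0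
            (Nat.mul_ne_zero (by omega) (by omega))
      _ ≤ rad a b (a + b) * ((a + b) * ((a + b) * (2 * (a + b)))) := by
          gcongr <;> omega
      _ = 2 * (a + b) ^ (4 - 1) * rad a b (a + b) := by ring
      _ ≤ 24 * (a + b) ^ (4 - 1) * rad a b (a + b) := by gcongr; norm_num

/-- `𝔅` (core): with `u = |2b - a|`, breed `c·u² + a²(3b-a) = 4b³` when `b ∉ □`, `a < 3b`. -/
theorem breed_B_core {a b u : ℕ} (ha : 0 < a) (hb : 0 < b) (hcop : Nat.Coprime a b)
    (hbns : ¬ IsSquare b) (h3 : a < 3 * b) (hu : u ≠ 0) (hu2 : u ≤ 2 * b)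
    (hpu : ∀ q : ℕ, q.Prime → q ∣ u → q ∣ b → q ∣ a)
    (hid : (a + b) * u ^ 2 + a ^ 2 * (3 * b - a) = 4 * b ^ 3) :
    ∃ A' B' C' : ℕ, IsABCTriple A' B' C' ∧ ¬ IsSquare C' ∧ (a + b) ^ 3 ≤ 81 * C' ∧
      rad A' B' C' ≤ 24 * (a + b) ^ (3 - 1) * rad a b (a + b) := by
  obtain ⟨p, hp, hodd⟩ := exists_odd_factorization_of_not_isSquare hb.ne' hbns
  have hpb : p ∣ b := dvd_of_odd_factorization hodd
  have hpA : ¬ p ∣ (a + b) * u ^ 2 := by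
    intro h
    rcases (Nat.Prime.dvd_mul hp).mp h with h' | h'
    · exact SparseGoodScales.Negative.not_dvd_of_coprime hp hcop ((Nat.dvd_add_left hpb).mp h') hpb
    · exact SparseGoodScales.Negative.not_dvd_of_coprime hp hcop (hpu p hp (hp.dvd_of_dvd_pow h') hpb) hpb
  refine breed_generic (A := (a + b) * u ^ 2) (B := a ^ 2 * (3 * b - a)) (C := 4 * b ^ 3)
    (κ := 4) (p := p) (by positivity) (Nat.mul_pos (by positivity) (by omega)) hid hpA ?_ ?_
    (by norm_num) ?_ ?_
  · have e4 : (4 : ℕ) = 2 ^ 2 := by norm_num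
    rw [Nat.factorization_mul (by norm_num) (by positivity), e4, Nat.factorization_pow,
      Nat.factorization_pow, Finsupp.add_apply, Finsupp.smul_apply, Finsupp.smul_apply, smul_eq_mul,
      smul_eq_mul]
    exact Even.add_odd (even_two_mul _) (Odd.mul (by decide) hodd)
  · have hgA := Nat.gcd_dvd_left ((a + b) * u ^ 2) (a ^ 2 * (3 * b - a))
    have hgB := Nat.gcd_dvd_right ((a + b) * u ^ 2) (a ^ 2 * (3 * b - a))
    have hgC : Nat.gcd ((a + b) * u ^ 2) (a ^ 2 * (3 * b - a)) ∣ 4 * b ^ 3 :=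
      hid ▸ dvd_add hgA hgB
    generalize Nat.gcd ((a + b) * u ^ 2) (a ^ 2 * (3 * b - a)) = g at hgA hgB hgC ⊢
    have hcb : Nat.Coprime g b := Nat.coprime_of_dvd fun q hq hqg hqb => by
      rcases (Nat.Prime.dvd_mul hq).mp (hqg.trans hgA) with h | h
      · exact SparseGoodScales.Negative.not_dvd_of_coprime hq hcop ((Nat.dvd_add_left hqb).mp h) hqb
      · exact SparseGoodScales.Negative.not_dvd_of_coprime hq hcop (hpu q hq (hq.dvd_of_dvd_pow h) hqb) hqb
    exact (Nat.Coprime.pow_right 3 hcb).dvd_of_dvd_mul_right hgC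
  · -- size: 4 c^3 ≤ 81 · 4 b³ from c ≤ 4b
    have hle : a + b ≤ 4 * b := by omega
    calc 4 * (a + b) ^ 3 ≤ 4 * (4 * b) ^ 3 := Nat.mul_le_mul_left _ (Nat.pow_le_pow_left hle 3)
      _ = 64 * (4 * b ^ 3) := by ring
      _ ≤ 81 * (4 * b ^ 3) := Nat.mul_le_mul_right _ (by norm_num)
  · have e : (a + b) * u ^ 2 * (a ^ 2 * (3 * b - a)) * (4 * b ^ 3) =
        (a ^ 2 * b ^ 3 * (a + b) ^ 1) * (u ^ 2 * (4 * (3 * b - a))) := by ring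
    rw [e]
    calc radical ((a ^ 2 * b ^ 3 * (a + b) ^ 1) * (u ^ 2 * (4 * (3 * b - a))))
          ≤ rad a b (a + b) * (u * (4 * (3 * b - a))) :=
          radical_bred_le ha hb (by positivity) (by norm_num) le_rfl (by norm_num) hu
            (Nat.mul_ne_zero (by norm_num) (by omega))
      _ ≤ rad a b (a + b) * ((2 * (a + b)) * (4 * (3 * (a + b)))) := by
          gcongr <;> omega
      _ = 24 * (a + b) ^ (3 - 1) * rad a b (a + b) := by ring

/-- `𝔅`: when `b ∉ □` and `a < 3b` (and `c ∈ □`, which excludes `a = 2b`). -/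
theorem breed_B {a b c : ℕ} (ht : IsABCTriple a b c) (hc : IsSquare c)
    (hbns : ¬ IsSquare b) (h3 : a < 3 * b) :
    ∃ A' B' C' : ℕ, IsABCTriple A' B' C' ∧ ¬ IsSquare C' ∧ c ^ 3 ≤ 81 * C' ∧
      rad A' B' C' ≤ 24 * c ^ (3 - 1) * rad a b c := by
  obtain ⟨ha, hb, rfl, hcop⟩ := ht
  have hne : a ≠ 2 * b := by
    rintro rfl
    -- gcd(2b, b) = b = 1, so c = 3, not a square
    have hb1 : b = 1 := by
      have := Nat.Coprime.gcd_eq_one hcop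
      rwa [Nat.gcd_mul_left_left] at this
    subst hb1
    obtain ⟨r, hr⟩ := hc
    have hr2 : r ≤ 2 := by nlinarith
    interval_cases r <;> omega
  rcases Nat.lt_or_gt_of_ne hne with hlt | hgt
  · -- u = 2b - a
    refine breed_B_core (u := 2 * b - a) ha hb hcop hbns h3 (by omega) (by omega) ?_ ?_
    · intro q hq hqu hqb
      have := Nat.dvd_sub (dvd_mul_of_dvd_right hqb 2) hqu
      rwa [Nat.sub_sub_self hlt.le] at this
    · zify [hlt.le, (by omega : a ≤ 3 * b)]
      ring
  · -- u = a - 2b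
    refine breed_B_core (u := a - 2 * b) ha hb hcop hbns h3 (by omega) (by omega) ?_ ?_
    · intro q hq hqu hqb
      have := dvd_add hqu (dvd_mul_of_dvd_right hqb 2)
      rwa [Nat.sub_add_cancel hgt.le] at this
    · zify [hgt.le, (by omega : a ≤ 3 * b)]
      ring

end Summit.ABC.ABC.Theorems.ParitySliceAssembly
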